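import Summits.ABC.ABC.Theorems.IneffectiveSubspaceTowerFourSubLiouvilleCoreIff

/-!
# The crux `TowerFourSubLiouville` follows from the Lang–Waldschmidt conjecture (four logarithms, bounded coefficients)

Helper (`--supports`) for the crux `Summit.ABC.ABC.Theses.IneffectiveSubspace.TowerFourSubLiouville`
(stmt-ABC-1649), line `fourth-radical-binomial-thue` (lead prover-line-stmt-ABC-1649-c1-0, 2026-08-16).

POSITION OF THE CRUX.  By the landed certificate `towerFourSubLiouville_iff_core` the crux is equivalent to a
uniform power saving over Liouville for the binomial quartic family: `|wZ⁴ − vY⁴| > Z^η` whenever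
`max(v,w) ≤ Z^η`, `Z ≥ Z₀` (some `η > 0`).  Two conjectures are known to imply it: `ABC` (landed,
`Negative.Framing.towerFourSubLiouville_of_abc`) and — proved here — the ARCHIMEDEAN Lang–Waldschmidt conjecture on
linear forms in logarithms of rational integers, in the product-of-heights form
`|b₁ log a₁ + ⋯ + bₘ log aₘ| ≥ C(ε)ᵐ · (B^{m−1} a₁⋯aₘ)^{−1−ε}` (S. Lang, *Elliptic Curves: Diophantine Analysis*
(1978) pp. 212–213; M. Waldschmidt, *Diophantine Approximation on Linear Algebraic Groups* (2000) Conj. 1.11),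
used ONLY in the instance `m = 4`, `|bᵢ| ≤ 4` (so `B` is absorbed into the constant), which is the hypothesis
`hLW` below, stated without auxiliary definitions.  This is the same mechanism by which Lang–Waldschmidt gives
Hall's conjecture `|x³ − y²| ≫ x^{1/2−ε}`; as there, the product form is essential (with `max aᵢ` in place of
`a₁⋯a₄` the bound is weaker than Liouville's here), and it is "only just enough": the linear form
`Λ = log w + 4 log Z − log v − 4 log Y = log(wZ⁴ / vY⁴)` of a violator has `|Λ| ≤ 2Z^{η−4}` while
`w·Z·v·Y ≤ 2Z^{2+9η/4}`, so the conjectured `|Λ| ≥ C (wZvY)^{−1−ε}` wins iff `(1+ε)(2 + 9η/4) < 4 − η`; we take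
`η = ε = 1/5` (`2.94 < 3.8`) and work in logarithmic coordinates, where everything is linear.

NO claim is made about the conjecture; the theorem is CONDITIONAL (`hLW` is an explicit hypothesis, not a tree fact),
recorded so that the planners can see the crux below a second standard conjecture that is not known to imply `ABC`.
-/

-- `Summit.ABC.ABC` is the mandated summit-side namespace (CONVENTIONS §2); the duplicate is deliberate.
set_option linter.dupNamespace false

namespace Summit.ABC.ABC.Theorems.TowerFourSubLiouville

open scoped BigOperators
open Summit.ABC.ABC.Theses.IneffectiveSubspace

/-- Mean-value bound for the logarithm: if `0 < m ≤ A` and `m ≤ B` then `|log A − log B| ≤ |A − B| / m`. -/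
theorem abs_log_sub_log_le {A B m : ℝ} (hm : 0 < m) (hA : m ≤ A) (hB : m ≤ B) :
    |Real.log A - Real.log B| ≤ |A - B| / m := by
  have hA0 : 0 < A := lt_of_lt_of_le hm hA
  have hB0 : 0 < B := lt_of_lt_of_le hm hB
  -- one-sided bound: `log X − log W ≤ (X − W)/W ≤ |X − W|/m` for `W ≥ m`
  have one_side : ∀ X W : ℝ, 0 < X → m ≤ W → Real.log X - Real.log W ≤ |X - W| / m := by
    intro X W hX hW
    have hW0 : 0 < W := lt_of_lt_of_le hm hW
    have h1 : Real.log X - Real.log W = Real.log (X / W) := (Real.log_div hX.ne' hW0.ne').symm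
    have h2 : Real.log (X / W) ≤ X / W - 1 := Real.log_le_sub_one_of_pos (div_pos hX hW0)
    have h3 : X / W - 1 = (X - W) / W := by field_simp
    have h4 : (X - W) / W ≤ |X - W| / m := by
      rcases le_or_gt 0 (X - W) with hpos | hneg
      · rw [abs_of_nonneg hpos]
        exact div_le_div_of_nonneg_left hpos hm hW
      · have : (X - W) / W ≤ 0 := div_nonpos_of_nonpos_of_nonneg hneg.le hW0.le
        exact this.trans (div_nonneg (abs_nonneg _) hm.le)
    linarith
  rw [abs_le]
  constructor
  · have h := one_side B A hB0 hA
    rw [abs_sub_comm] at h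
    linarith
  · exact one_side A B hA0 hB

/-- The sum `∑ bᵢ log aᵢ` for `a = (w, Z, v, Y)`, `b = (1, 4, −1, −4)` is `log w + 4 log Z − log v − 4 log Y`. -/
theorem lw_sum_eval (w Z v Y : ℕ) :
    (∑ i : Fin 4, (((![1, 4, -1, -4] : Fin 4 → ℤ) i : ℤ) : ℝ) * Real.log (((![w, Z, v, Y] : Fin 4 → ℕ) i : ℕ) : ℝ))
      = Real.log w + 4 * Real.log Z - Real.log v - 4 * Real.log Y := by
  simp only [Fin.sum_univ_four, Matrix.cons_val_zero, Matrix.cons_val_one, Matrix.cons_val_two,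
    Matrix.cons_val_three, Matrix.head_cons, Matrix.tail_cons]
  push_cast
  ring

/-- The product `∏ aᵢ` for `a = (w, Z, v, Y)` is `w·Z·v·Y`. -/
theorem lw_prod_eval (w Z v Y : ℕ) :
    (((∏ i : Fin 4, (![w, Z, v, Y] : Fin 4 → ℕ) i : ℕ) : ℝ)) = (w : ℝ) * Z * v * Y := by
  simp only [Fin.prod_univ_four, Matrix.cons_val_zero, Matrix.cons_val_one, Matrix.cons_val_two,
    Matrix.cons_val_three, Matrix.head_cons, Matrix.tail_cons]
  push_cast
  ring

/-- Entries of `(w, Z, v, Y)` are positive when the four numbers are. -/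
theorem lw_entries_pos {w Z v Y : ℕ} (hw : 0 < w) (hZ : 0 < Z) (hv : 0 < v) (hY : 0 < Y) :
    ∀ i : Fin 4, 0 < (![w, Z, v, Y] : Fin 4 → ℕ) i := by
  intro i
  fin_cases i
  · simpa using hw
  · simpa using hZ
  · simpa using hv
  · simpa using hY

/-- The coefficients `(1, 4, −1, −4)` are bounded by `4` in absolute value. -/
theorem lw_coeffs_le : ∀ i : Fin 4, |(![1, 4, -1, -4] : Fin 4 → ℤ) i| ≤ 4 := by
  intro i
  fin_cases i <;> simp

/-- **The crux from Lang–Waldschmidt.**  If the Lang–Waldschmidt lower bound holds for linear forms in four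
logarithms of positive integers with coefficients bounded by `4` — for every `ε > 0` some `C > 0` has
`|∑ bᵢ log aᵢ| ≥ C · (a₁a₂a₃a₄)^{−(1+ε)}` whenever the form is non-zero — then `TowerFourSubLiouville` holds.
Proof: a violator `(v,w,Y,Z)` of the core saving with `η = 1/5` gives the non-zero form
`Λ = log w + 4 log Z − log v − 4 log Y` with `|Λ| ≤ 2 Z^{1/5 − 4}` and `wZvY ≤ 2 Z^{49/20}`; with `ε = 1/5` the
hypothesis forces `(43/50) log Z ≤ (11/5) log 2 − log C`, i.e. `Z` bounded; conclude by `towerFourSubLiouville_iff_core`. -/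
theorem towerFourSubLiouville_of_langWaldschmidt
    (hLW : ∀ ε : ℝ, 0 < ε → ∃ C : ℝ, 0 < C ∧ ∀ a : Fin 4 → ℕ, ∀ b : Fin 4 → ℤ, (∀ i, 0 < a i) →
      (∀ i, |b i| ≤ 4) → (∑ i, (b i : ℝ) * Real.log (a i : ℝ)) ≠ 0 →
      C * (((∏ i, a i : ℕ) : ℝ)) ^ (-(1 + ε)) ≤ |∑ i, (b i : ℝ) * Real.log (a i : ℝ)|) :
    TowerFourSubLiouville := by
  obtain ⟨C, hC, hLW⟩ := hLW (1 / 5) (by norm_num)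
  -- the height threshold: `log Z > L₀ := ((11/5) log 2 − log C) / (43/50)`
  obtain ⟨L₀, hL₀⟩ : ∃ L₀ : ℝ, L₀ = ((11 / 5) * Real.log 2 - Real.log C) / (43 / 50) := ⟨_, rfl⟩
  obtain ⟨Z₀, hZ₀⟩ : ∃ Z₀ : ℕ, Real.exp L₀ < Z₀ := exists_nat_gt (Real.exp L₀)
  refine towerFourSubLiouville_iff_core.mpr ⟨1 / 5, by norm_num, 0, max Z₀ 2, ?_⟩
  intro v w Y Z hZ _hH _hvf _hwf hv hw hY _hcop hmax hne
  -- positivity and casts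
  have hZ2 : 2 ≤ Z := le_trans (le_max_right _ _) hZ
  have hZ0le : Z₀ ≤ Z := le_trans (le_max_left _ _) hZ
  have hZpos : 0 < Z := lt_of_lt_of_le two_pos hZ2
  have hZr2 : (2 : ℝ) ≤ (Z : ℝ) := by exact_mod_cast hZ2
  have hZr : (0 : ℝ) < (Z : ℝ) := by linarith
  have hvr : (0 : ℝ) < (v : ℝ) := by exact_mod_cast hv
  have hwr : (0 : ℝ) < (w : ℝ) := by exact_mod_cast hw
  have hYr : (0 : ℝ) < (Y : ℝ) := by exact_mod_cast hY
  have hw1 : (1 : ℝ) ≤ (w : ℝ) := by exact_mod_cast hw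
  have hv1 : (1 : ℝ) ≤ (v : ℝ) := by exact_mod_cast hv
  have hlog2 : (0 : ℝ) < Real.log 2 := Real.log_pos (by norm_num)
  -- `log Z > L₀`
  have hlogZ : L₀ < Real.log (Z : ℝ) := by
    have h1 : Real.exp L₀ < (Z : ℝ) := lt_of_lt_of_le hZ₀ (by exact_mod_cast hZ0le)
    have := Real.log_lt_log (Real.exp_pos L₀) h1
    rwa [Real.log_exp] at this
  -- the two sides `A = wZ⁴`, `B = vY⁴`
  obtain ⟨A, hAeq⟩ : ∃ A : ℝ, A = (w : ℝ) * (Z : ℝ) ^ 4 := ⟨_, rfl⟩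
  obtain ⟨B, hBeq⟩ : ∃ B : ℝ, B = (v : ℝ) * (Y : ℝ) ^ 4 := ⟨_, rfl⟩
  have hA0 : 0 < A := by rw [hAeq]; positivity
  have hB0 : 0 < B := by rw [hBeq]; positivity
  have hAB : A ≠ B := by
    rw [hAeq, hBeq]; exact_mod_cast hne
  -- suppose the saving fails: `|A − B| ≤ Z^{1/5}`
  by_contra hfail
  rw [not_lt] at hfail
  have hfail' : |A - B| ≤ (Z : ℝ) ^ (1 / 5 : ℝ) := by
    rw [hAeq, hBeq]; push_cast at hfail; exact hfail
  -- `Z^{1/5} ≤ Z ≤ Z⁴/8`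
  have hZ15 : (Z : ℝ) ^ (1 / 5 : ℝ) ≤ (Z : ℝ) := by
    have h := Real.rpow_le_rpow_of_exponent_le (le_trans one_le_two hZr2) (show (1 / 5 : ℝ) ≤ 1 by norm_num)
    rwa [Real.rpow_one] at h
  have hZ3 : (8 : ℝ) ≤ (Z : ℝ) ^ 3 := by
    have h := pow_le_pow_left₀ (by norm_num : (0 : ℝ) ≤ 2) hZr2 3
    norm_num at h
    exact h
  have hZ4 : (8 : ℝ) * (Z : ℝ) ≤ (Z : ℝ) ^ 4 := by
    have h : (Z : ℝ) ^ 4 = (Z : ℝ) ^ 3 * (Z : ℝ) := by ring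
    rw [h]
    nlinarith [hZ3, hZr]
  have hsmall : |A - B| ≤ (Z : ℝ) ^ 4 / 8 := by
    have := hfail'.trans hZ15; linarith
  -- both sides are at least `Z⁴/2`
  have hZ4pos : (0 : ℝ) < (Z : ℝ) ^ 4 := pow_pos hZr 4
  have hAge : (Z : ℝ) ^ 4 ≤ A := by
    rw [hAeq]; nlinarith [hZ4pos, hw1]
  have hBge : (Z : ℝ) ^ 4 / 2 ≤ B := by
    have h1 : A - B ≤ |A - B| := le_abs_self _
    linarith
  have hm : (0 : ℝ) < (Z : ℝ) ^ 4 / 2 := by positivity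
  have hAge' : (Z : ℝ) ^ 4 / 2 ≤ A := by linarith
  -- the linear form and its smallness: `|log A − log B| ≤ Z^{1/5} / (Z⁴/2)`
  have hΛsmall : |Real.log A - Real.log B| ≤ (Z : ℝ) ^ (1 / 5 : ℝ) / ((Z : ℝ) ^ 4 / 2) :=
    (abs_log_sub_log_le hm hAge' hBge).trans (div_le_div_of_nonneg_right hfail' hm.le)
  have hΛne : Real.log A - Real.log B ≠ 0 := by
    rw [← Real.log_div hA0.ne' hB0.ne']
    apply Real.log_ne_zero_of_pos_of_ne_one (div_pos hA0 hB0)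
    intro h1
    exact hAB ((div_eq_one_iff_eq hB0.ne').mp h1)
  have hΛpos : 0 < |Real.log A - Real.log B| := abs_pos.mpr hΛne
  -- expand `log A − log B = log w + 4 log Z − log v − 4 log Y`
  have hlogA : Real.log A = Real.log w + 4 * Real.log (Z : ℝ) := by
    rw [hAeq, Real.log_mul hwr.ne' hZ4pos.ne', Real.log_pow]; push_cast; ring
  have hlogB : Real.log B = Real.log v + 4 * Real.log (Y : ℝ) := by
    rw [hBeq, Real.log_mul hvr.ne' (pow_pos hYr 4).ne', Real.log_pow]; push_cast; ring
  have hΛeval : Real.log w + 4 * Real.log Z - Real.log v - 4 * Real.log Y = Real.log A - Real.log B := by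
    rw [hlogA, hlogB]; ring
  -- the Lang–Waldschmidt instance `a = (w, Z, v, Y)`, `b = (1, 4, −1, −4)`
  have hLWinst := hLW (![w, Z, v, Y]) (![1, 4, -1, -4]) (lw_entries_pos hw hZpos hv hY) lw_coeffs_le
    (by rw [lw_sum_eval, hΛeval]; exact hΛne)
  rw [lw_sum_eval, hΛeval, lw_prod_eval] at hLWinst
  -- sizes: `P = wZvY ≤ 2 Z^{49/20}` in log form
  obtain ⟨P, hP⟩ : ∃ P : ℝ, P = (w : ℝ) * Z * v * Y := ⟨_, rfl⟩
  rw [← hP] at hLWinst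
  have hP0 : 0 < P := by rw [hP]; positivity
  have hlogw : Real.log w ≤ (1 / 5 : ℝ) * Real.log (Z : ℝ) := by
    have h1 : (w : ℝ) ≤ (Z : ℝ) ^ (1 / 5 : ℝ) := le_trans (Nat.cast_le.mpr (le_max_right v w)) hmax
    have := Real.log_le_log hwr h1
    rwa [Real.log_rpow hZr] at this
  have hlogv : Real.log v ≤ (1 / 5 : ℝ) * Real.log (Z : ℝ) := by
    have h1 : (v : ℝ) ≤ (Z : ℝ) ^ (1 / 5 : ℝ) := le_trans (Nat.cast_le.mpr (le_max_left v w)) hmax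
    have := Real.log_le_log hvr h1
    rwa [Real.log_rpow hZr] at this
  have hlogw0 : 0 ≤ Real.log w := Real.log_nonneg hw1
  -- `Y⁴ ≤ B ≤ A + |A − B| ≤ 2·wZ⁴`, so `4 log Y ≤ log 2 + log w + 4 log Z`
  have hlogY : 4 * Real.log Y ≤ Real.log 2 + Real.log w + 4 * Real.log (Z : ℝ) := by
    have hY4 : (Y : ℝ) ^ 4 ≤ B := by rw [hBeq]; nlinarith [pow_pos hYr 4, hv1]
    have hBle : B ≤ 2 * A := by
      have h1 : B - A ≤ |A - B| := by rw [abs_sub_comm]; exact le_abs_self _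
      linarith
    have h2 : (Y : ℝ) ^ 4 ≤ 2 * ((w : ℝ) * (Z : ℝ) ^ 4) := by rw [← hAeq]; linarith
    have h3 := Real.log_le_log (pow_pos hYr 4) h2
    rw [Real.log_pow, Real.log_mul (x := (2 : ℝ)) (y := (w : ℝ) * (Z : ℝ) ^ 4) two_ne_zero (by positivity),
      Real.log_mul (x := (w : ℝ)) (y := (Z : ℝ) ^ 4) hwr.ne' hZ4pos.ne', Real.log_pow] at h3
    push_cast at h3
    linarith
  have hlogP : Real.log P ≤ Real.log 2 + (49 / 20 : ℝ) * Real.log (Z : ℝ) := by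
    have h : Real.log P = Real.log w + Real.log Z + Real.log v + Real.log Y := by
      rw [hP, Real.log_mul (x := (w : ℝ) * Z * v) (y := (Y : ℝ)) (by positivity) hYr.ne',
        Real.log_mul (x := (w : ℝ) * Z) (y := (v : ℝ)) (by positivity) hvr.ne',
        Real.log_mul (x := (w : ℝ)) (y := (Z : ℝ)) hwr.ne' hZr.ne']
    rw [h]
    linarith
  -- logarithmic form of the Lang–Waldschmidt instance: `log C − (6/5) log P ≤ log |Λ|`
  have hLWlog : Real.log C - (6 / 5 : ℝ) * Real.log P ≤ Real.log |Real.log A - Real.log B| := by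
    have hrp : 0 < P ^ (-(1 + 1 / 5 : ℝ)) := Real.rpow_pos_of_pos hP0 _
    have h1 : 0 < C * P ^ (-(1 + 1 / 5 : ℝ)) := mul_pos hC hrp
    have h2 := Real.log_le_log h1 hLWinst
    rw [Real.log_mul hC.ne' hrp.ne', Real.log_rpow hP0] at h2
    have h3 : (-(1 + 1 / 5 : ℝ)) * Real.log P = -((6 / 5 : ℝ) * Real.log P) := by ring
    rw [h3] at h2
    linarith
  -- logarithmic form of the smallness: `log |Λ| ≤ (1/5) log Z + log 2 − 4 log Z`
  have hsmallLog : Real.log |Real.log A - Real.log B| ≤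
      (1 / 5 : ℝ) * Real.log (Z : ℝ) + Real.log 2 - 4 * Real.log (Z : ℝ) := by
    have h1 := Real.log_le_log hΛpos hΛsmall
    have h2 : Real.log ((Z : ℝ) ^ (1 / 5 : ℝ) / ((Z : ℝ) ^ 4 / 2)) =
        (1 / 5 : ℝ) * Real.log (Z : ℝ) + Real.log 2 - 4 * Real.log (Z : ℝ) := by
      rw [Real.log_div (Real.rpow_pos_of_pos hZr _).ne' hm.ne', Real.log_rpow hZr,
        Real.log_div hZ4pos.ne' two_ne_zero, Real.log_pow]
      push_cast; ring
    linarith [h1, h2]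
  -- combine: `(43/50) log Z ≤ (11/5) log 2 − log C`, contradicting `log Z > L₀`
  have hcomb : (43 / 50 : ℝ) * Real.log (Z : ℝ) ≤ (11 / 5) * Real.log 2 - Real.log C := by
    linarith [hLWlog, hsmallLog, hlogP]
  have hLle : Real.log (Z : ℝ) ≤ L₀ := by
    rw [hL₀, le_div_iff₀ (by norm_num : (0 : ℝ) < 43 / 50)]
    linarith
  linarith

/-- Registered form (`stub_cruxOfLangWaldschmidt` on stmt-ABC-1649) of `towerFourSubLiouville_of_langWaldschmidt`: the
m = 4, `|bᵢ| ≤ 4` case of the Lang–Waldschmidt conjecture (product-of-heights form) implies the crux. -/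
theorem stub_cruxOfLangWaldschmidt : (∀ ε : ℝ, 0 < ε → ∃ C : ℝ, 0 < C ∧ ∀ a : Fin 4 → ℕ, ∀ b : Fin 4 → ℤ, (∀ i, 0 < a i) → (∀ i, |b i| ≤ 4) → (∑ i, (b i : ℝ) * Real.log (a i : ℝ)) ≠ 0 → C * (((∏ i, a i : ℕ) : ℝ)) ^ (-(1 + ε)) ≤ |∑ i, (b i : ℝ) * Real.log (a i : ℝ)|) → Summit.ABC.ABC.Theses.IneffectiveSubspace.TowerFourSubLiouville :=
  towerFourSubLiouville_of_langWaldschmidt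

end Summit.ABC.ABC.Theorems.TowerFourSubLiouville
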